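import Literature.AlgebraicGeometry.Smoothening.DilatationDefectData
import Literature.AlgebraicGeometry.Smoothening.CentreLinearPart
import Literature.AlgebraicGeometry.Smoothening.CentreIndependence
import Literature.AlgebraicGeometry.Smoothening.CentreGenerators
import Literature.AlgebraicGeometry.Smoothening.FibreDimension
import Literature.AlgebraicGeometry.Smoothening.FibreDimensionPoint
import HarnessLib

/-!
# BLR Prop. 3.3/5 at a point: Néron's measure drops by one under the dilatation

Topic: `Literature/AlgebraicGeometry/Smoothening` (Bosch–Lütkebohmert–Raynaud, *Néron Models*,
§3.3, Lemma 4 and Prop. 5; M. Artin, *Néron Models*, Lemma (3.9)). This file assembles the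
pointwise form of the key step of the smoothening process from the bricks of this directory.

**Setting.** `B ⊇ 𝔟̃ = (ϖ, g₁, …, g_r) ⊇ I`, `A = B/I` (`X = Spec A`, an `R`-scheme inside
`Spec B` with `Ω[B⁄R]` finite free, e.g. `B = R[T₁, …, T_N]`), `C = B/𝔟̃` (the centre
`U = V(𝔟̃) ⊆ X_k`), `X' = Spec A[𝔟/ϖ]` the dilatation; `a : A → S`, `a' : A[𝔟/ϖ] → S` compatible
points with values in a discrete valuation ring `S` in which `ϖ` is a uniformizer, `k'` its
residue field; `𝔓` a prime of `C` and `L = C_𝔓` (the local ring of the centre at the closed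
point of `a`: `hunit` says that functions on `Spec B` non-zero at `𝔓` are units at `a`), with
`L → k'` compatible.

**Hypotheses** (what BLR Lemma 3.3/4 provides for the points of `E` specializing into `U_k`):
the centre is smooth at the point — the residues of the `dgⱼ` are linearly independent, over
`k'` (`hres`) and over `κ(𝔓)` (`hresκ`); `Ω¹_{X/R}|_U` is free at the point
(`Module.Free L (L ⊗_A Ω[A⁄R])`); density (`hinj`: `A/𝔟 → A[𝔟/ϖ]/(ϖ)` injective); and `X` is
not smooth at `a`, i.e. `δ(a) ≠ 0` (`hδ`, BLR Lemma 3.3/1).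

**Theorem** (`neronDefect_dilatation_add_one_le`): `δ(a') + 1 ≤ δ(a)`.

**Proof.** `CentreGenerators` (Nakayama over `L`) chooses `p = N - q` equations `Fᵢ ∈ I` whose
restricted differentials generate those of all `f ∈ I` near `𝔓`; `CentreIndependence` turns the
residue independence into the independence hypotheses of `CentreLinearPart` (`hind`) and of
`DilatationLattice` (`hγ`); `CentreLinearPart` gives `I ⊆ (F) + ((ϖ) + 𝔟̃·(g))` up to units at
`a`; `DilatationDefectData` (density, Noetherianity) and `DilatationDefectDrop`/`DilatationDefect`
(`TorsionDrop`) give `δ(a') + N ≤ δ(a) + p + rank_S a*Ω¹`; finally `p + q = N`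
(`CentreGenerators`), `q = ℓ_S(a*Ω¹/π)` (`FibreDimensionPoint`) and `ℓ_S(a*Ω¹/π) ≥ rank + 1`
(`FibreDimension`, as `δ(a) ≠ 0`) give `δ(a') + 1 ≤ δ(a)`. No named facts (D-0026).

## References

* S. Bosch, W. Lütkebohmert, M. Raynaud, *Néron Models*, Springer 1990, §3.3, Lemma 4,
  Prop. 5. [BLRNeronModels1990] (Not held; numbers only.)
* M. Artin, *Néron Models*, in: G. Cornell, J. H. Silverman (eds.), *Arithmetic Geometry*,
  Springer 1986, Lemma (3.9) (pp. 226–227). [Artin1986NeronModels]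
-/

noncomputable section

open scoped TensorProduct
open KaehlerDifferential IsLocalRing Literature.AlgebraicGeometry.Dilatations

namespace Literature.AlgebraicGeometry.Smoothening

universe u

variable {R : Type u} [CommRing R] (ϖ : R) {B : Type u} [CommRing B] [Algebra R B]
  [IsNoetherianRing B] [Module.Free B Ω[B⁄R]] [Module.Finite B Ω[B⁄R]]
  (I : Ideal B) {r : ℕ} (g : Fin r → B)
  [Module.Finite (B ⧸ I) Ω[(B ⧸ I)⁄R]]
  -- the centre `C = B/𝔟̃` as an `A`-algebra
  [Algebra (B ⧸ I) (B ⧸ centreIdealB ϖ g)] [IsScalarTower B (B ⧸ I) (B ⧸ centreIdealB ϖ g)]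
  [IsScalarTower R (B ⧸ I) (B ⧸ centreIdealB ϖ g)]
  -- the local ring of the centre at the closed point
  (𝔓 : Ideal (B ⧸ centreIdealB ϖ g)) [𝔓.IsPrime]
  (L : Type u) [CommRing L] [IsLocalRing L] [Algebra (B ⧸ centreIdealB ϖ g) L]
  [IsLocalization.AtPrime L 𝔓]
  [Algebra B L] [IsScalarTower B (B ⧸ centreIdealB ϖ g) L]
  [Algebra (B ⧸ I) L] [IsScalarTower (B ⧸ I) (B ⧸ centreIdealB ϖ g) L]
  -- the point
  (S : Type u) [CommRing S] [IsDomain S] [IsDiscreteValuationRing S] [Algebra R S]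
  [Algebra B S] [Algebra (B ⧸ I) S]
  [Algebra (dilatation ϖ (centreIdeal ϖ I g)) S]
  [IsScalarTower R B S]
  [IsScalarTower B (B ⧸ I) S]
  [IsScalarTower R (B ⧸ I) S]
  [IsScalarTower (B ⧸ I) (dilatation ϖ (centreIdeal ϖ I g)) S]
  [IsScalarTower R (dilatation ϖ (centreIdeal ϖ I g)) S]
  -- `L → k'` compatible with the point
  [Algebra L (ResidueField S)] [IsScalarTower (B ⧸ I) L (ResidueField S)]

omit [Module.Finite (B ⧸ I) Ω[(B ⧸ I)⁄R]] [Algebra L (ResidueField S)]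
  [IsScalarTower (B ⧸ I) L (ResidueField S)] in
set_option maxHeartbeats 800000 in
/-- The common core of `neronDefect_dilatation_le` / `neronDefect_dilatation_add_one_le`:
`δ(a') + N ≤ δ(a) + p + rank_S a*Ω¹` with `p + q = N`, `q = rank_L (L ⊗_A Ω[A⁄R])`. [folklore] -/
theorem neronDefect_dilatation_add_le_aux (hπ : Irreducible (algebraMap R S ϖ))
    (hres : LinearIndependent (ResidueField S)
      (fun j => (1 : ResidueField S) ⊗ₜ[B] D R B (g j)))
    (hresκ : LinearIndependent (ResidueField L)
      (fun j => (1 : ResidueField L) ⊗ₜ[B] D R B (g j)))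
    [Module.Free L (L ⊗[B ⧸ I] Ω[(B ⧸ I)⁄R])]
    (hinj : Function.Injective (Ideal.quotientMap
      (Ideal.span {algebraMap R (dilatation ϖ (centreIdeal ϖ I g)) ϖ})
      (algebraMap (B ⧸ I) (dilatation ϖ (centreIdeal ϖ I g)))
      (Ideal.map_le_iff_le_comap.mp (map_centreIdeal_dilatation_le ϖ I g))))
    (hI : I ≤ centreIdealB ϖ g)
    (hunit : ∀ t : B, Ideal.Quotient.mk (centreIdealB ϖ g) t ∉ 𝔓 → IsUnit (algebraMap B S t)) :
    ∃ p : ℕ, neronDefect R (dilatation ϖ (centreIdeal ϖ I g)) S + Module.finrank B Ω[B⁄R] ≤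
        neronDefect R (B ⧸ I) S + p + Module.finrank S (S ⊗[B ⧸ I] Ω[(B ⧸ I)⁄R]) ∧
      p + Module.finrank L (L ⊗[B ⧸ I] Ω[(B ⧸ I)⁄R]) = Module.finrank B Ω[B⁄R] := by
  classical
  -- Step 1: the restricted differentials `W = C ⊗_B Ω[B⁄R]`, `γ_f = 1 ⊗ df`
  let γ : I → (B ⧸ centreIdealB ϖ g) ⊗[B] Ω[B⁄R] :=
    fun f => (1 : B ⧸ centreIdealB ϖ g) ⊗ₜ[B] D R B (f : B)
  have hγspan : Submodule.span (B ⧸ centreIdealB ϖ g) (Set.range γ) =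
      conormalSpan R B I (B ⧸ centreIdealB ϖ g) := rfl
  -- `L ⊗_C (W / conormalSpan) ≅ L ⊗_A Ω[A⁄R]` is free of rank `q`
  let e₁ := quotientConormalSpanEquiv R B I (B ⧸ centreIdealB ϖ g)
  let e₂ := TensorProduct.AlgebraTensorModule.cancelBaseChange (B ⧸ I) (B ⧸ centreIdealB ϖ g) L L
    Ω[(B ⧸ I)⁄R]
  let e₁₂ : L ⊗[B ⧸ centreIdealB ϖ g]
      (((B ⧸ centreIdealB ϖ g) ⊗[B] Ω[B⁄R]) ⧸ Submodule.span (B ⧸ centreIdealB ϖ g) (Set.range γ))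
        ≃ₗ[L] L ⊗[B ⧸ I] Ω[(B ⧸ I)⁄R] :=
    (TensorProduct.AlgebraTensorModule.congr (LinearEquiv.refl L L) e₁) ≪≫ₗ e₂
  haveI : Module.Free L (L ⊗[B ⧸ centreIdealB ϖ g]
      (((B ⧸ centreIdealB ϖ g) ⊗[B] Ω[B⁄R]) ⧸ Submodule.span (B ⧸ centreIdealB ϖ g) (Set.range γ))) :=
    Module.Free.of_equiv e₁₂.symm
  have hq : Module.finrank L (L ⊗[B ⧸ centreIdealB ϖ g]
      (((B ⧸ centreIdealB ϖ g) ⊗[B] Ω[B⁄R]) ⧸ Submodule.span (B ⧸ centreIdealB ϖ g) (Set.range γ))) =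
      Module.finrank L (L ⊗[B ⧸ I] Ω[(B ⧸ I)⁄R]) := e₁₂.finrank_eq
  -- Step 2: choose `p = N - q` equations by Nakayama
  obtain ⟨p, F, hp, hgen'⟩ :=
    exists_generators_of_free_localization 𝔓 L γ
  have hN : Module.finrank (B ⧸ centreIdealB ϖ g) ((B ⧸ centreIdealB ϖ g) ⊗[B] Ω[B⁄R]) =
      Module.finrank B Ω[B⁄R] := by
    haveI : Nontrivial (B ⧸ centreIdealB ϖ g) := ⟨⟨0, 1, fun h01 =>
      (Ideal.ne_top_iff_one 𝔓).mp (Ideal.IsPrime.ne_top inferInstance) (h01 ▸ 𝔓.zero_mem)⟩⟩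
    haveI : Nontrivial B := (Ideal.Quotient.mk (centreIdealB ϖ g)).domain_nontrivial
    exact Module.finrank_baseChange
  rw [hq, hN] at hp
  -- Step 3: independence hypotheses from the residues
  have hind : ∀ c : Fin r → B,
      (∑ j, Ideal.Quotient.mk (centreIdealB ϖ g) (c j) •
        ((1 : B ⧸ centreIdealB ϖ g) ⊗ₜ[B] D R B (g j)) = 0) →
      ∃ t ∈ (𝔓.primeCompl.comap (Ideal.Quotient.mk (centreIdealB ϖ g))), ∀ j,
        t * c j ∈ centreIdealB ϖ g := fun c hc => by
    obtain ⟨t, ht, htc⟩ := exists_mul_mem_of_linearIndependent_residue ϖ g 𝔓 L hresκ c hc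
    exact ⟨t, ht, htc⟩
  have hγ := dvd_of_linearIndependent_residue (R := R) g S hπ hres
  -- Step 4: the generation `I ⊆ (F) + ((ϖ) + 𝔟̃·(g))` up to units at the point
  have hgenW : ∀ f ∈ I, ∃ t ∈ (𝔓.primeCompl.comap (Ideal.Quotient.mk (centreIdealB ϖ g))),
      ∃ c : Fin p → B,
      Ideal.Quotient.mk (centreIdealB ϖ g) t • ((1 : B ⧸ centreIdealB ϖ g) ⊗ₜ[B] D R B f) =
        ∑ i, Ideal.Quotient.mk (centreIdealB ϖ g) (c i) •
          ((1 : B ⧸ centreIdealB ϖ g) ⊗ₜ[B] D R B ((F i : I) : B)) := by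
    intro f hf
    obtain ⟨t, ht, c, htc⟩ := hgen' ⟨f, hf⟩
    obtain ⟨t', rfl⟩ := Ideal.Quotient.mk_surjective t
    refine ⟨t', ht, fun i => (Ideal.Quotient.mk_surjective (c i)).choose, ?_⟩
    simp only [(Ideal.Quotient.mk_surjective (c _)).choose_spec]
    exact htc
  have hgen₁ : ∀ f ∈ I, ∃ t ∈ (𝔓.primeCompl.comap (Ideal.Quotient.mk (centreIdealB ϖ g))),
      t * f ∈ Ideal.span (Set.range fun i => ((F i : I) : B)) ⊔ vanishingLinearPart ϖ g :=
    fun f hf => exists_mul_mem_span_sup_vanishingLinearPart ϖ g _ hI hind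
      (fun i => ((F i : I) : B)) (fun i => (F i).2) hgenW hf
  -- Step 5: write `Fᵢ = ϖ f₀ᵢ + Σ gⱼ fᵢⱼ`
  have hdec : ∀ i, ∃ (f0 : B) (fc : Fin r → B),
      ((F i : I) : B) = algebraMap R B ϖ * f0 + ∑ j, g j * fc j := by
    intro i
    have hFi : ((F i : I) : B) ∈ centreIdealB ϖ g := hI (F i).2
    rw [centreIdealB, Ideal.span_insert] at hFi
    obtain ⟨x, hx, y, hy, hxy⟩ := Submodule.mem_sup.mp hFi
    obtain ⟨f0, rfl⟩ := Ideal.mem_span_singleton'.mp hx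
    obtain ⟨fc, rfl⟩ := (Ideal.mem_span_range_iff_exists_fun).mp hy
    refine ⟨f0, fc, ?_⟩
    rw [← hxy, mul_comm]
    simp only [mul_comm (fc _)]
  choose f0 fc hF using hdec
  have hFeq : (fun i => ((F i : I) : B)) = fun i => algebraMap R B ϖ * f0 i + ∑ j, g j * fc i j :=
    funext hF
  have hf : ∀ i, algebraMap R B ϖ * f0 i + ∑ j, g j * fc i j ∈ I := fun i => hF i ▸ (F i).2
  -- Step 6: the defect drop from the generator data
  have hU : ∀ u ∈ (𝔓.primeCompl.comap (Ideal.Quotient.mk (centreIdealB ϖ g))),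
      IsUnit (algebraMap B S u) := fun u hu => hunit u hu
  have hdrop := neronDefect_dilatation_add_finrank_le_of_density ϖ I g S hπ hγ hinj hI f0 fc hf
    (𝔓.primeCompl.comap (Ideal.Quotient.mk (centreIdealB ϖ g))) hU (by rw [← hFeq]; exact hgen₁)
  exact ⟨p, hdrop, hp⟩

/-- **BLR Prop. 3.3/5 at a point, weak form: `δ(a') ≤ δ(a)`** for every point through the
(smooth, `Ω`-free, dense) centre — Néron's measure never increases under the dilatation.
[cite: Artin1986NeronModels, Lemma (3.9) (p. 227)] -/
theorem neronDefect_dilatation_le (hπ : Irreducible (algebraMap R S ϖ))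
    (hres : LinearIndependent (ResidueField S)
      (fun j => (1 : ResidueField S) ⊗ₜ[B] D R B (g j)))
    (hresκ : LinearIndependent (ResidueField L)
      (fun j => (1 : ResidueField L) ⊗ₜ[B] D R B (g j)))
    [Module.Free L (L ⊗[B ⧸ I] Ω[(B ⧸ I)⁄R])]
    (hinj : Function.Injective (Ideal.quotientMap
      (Ideal.span {algebraMap R (dilatation ϖ (centreIdeal ϖ I g)) ϖ})
      (algebraMap (B ⧸ I) (dilatation ϖ (centreIdeal ϖ I g)))
      (Ideal.map_le_iff_le_comap.mp (map_centreIdeal_dilatation_le ϖ I g))))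
    (hI : I ≤ centreIdealB ϖ g)
    (hunit : ∀ t : B, Ideal.Quotient.mk (centreIdealB ϖ g) t ∉ 𝔓 → IsUnit (algebraMap B S t)) :
    neronDefect R (dilatation ϖ (centreIdeal ϖ I g)) S ≤ neronDefect R (B ⧸ I) S := by
  obtain ⟨p, hdrop, hp⟩ := neronDefect_dilatation_add_le_aux ϖ I g 𝔓 L S hπ hres hresκ hinj hI hunit
  have hq' := length_quotSMulTop_tensor_kaehler_eq_finrank R (B ⧸ I) S L hπ
  have hnum : (Module.finrank S (S ⊗[B ⧸ I] Ω[(B ⧸ I)⁄R]) : ℕ∞) ≤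
      Module.finrank L (L ⊗[B ⧸ I] Ω[(B ⧸ I)⁄R]) := by
    rw [← hq', length_quotSMulTop_eq_finrank_add (S ⊗[B ⧸ I] Ω[(B ⧸ I)⁄R]) hπ]
    exact le_self_add
  set δ' := neronDefect R (dilatation ϖ (centreIdeal ϖ I g)) S
  set δ := neronDefect R (B ⧸ I) S
  set N := Module.finrank B Ω[B⁄R]
  set q := Module.finrank L (L ⊗[B ⧸ I] Ω[(B ⧸ I)⁄R])
  set m := Module.finrank S (S ⊗[B ⧸ I] Ω[(B ⧸ I)⁄R])
  have hfin : ((N : ℕ) : ℕ∞) ≠ ⊤ := ENat.coe_ne_top _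
  have key : δ' + N ≤ δ + N := by
    calc δ' + (N : ℕ∞) ≤ δ + p + m := hdrop
      _ ≤ δ + p + q := add_le_add le_rfl hnum
      _ = δ + ((p + q : ℕ) : ℕ∞) := by push_cast; ring
      _ = δ + N := by rw [hp]
  exact (WithTop.add_le_add_iff_right hfin).mp key

/-- **BLR Prop. 3.3/5 at a point (Artin, Lemma (3.9): "`l(x₁') < l(x')`").** In the setting of
the module docstring: if the centre is smooth at the closed point of `a` (`hres`, `hresκ`),
`Ω¹_{X/R}` restricted to the centre is free there, the exceptional fibre is schematically dense
over the centre (`hinj`), and `δ(a) ≠ 0`, then Néron's measure for the defect of smoothness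
satisfies `δ(a') + 1 ≤ δ(a)` for the lifted point `a'` of the dilatation `Spec A[𝔟/ϖ]`.
[cite: Artin1986NeronModels, Lemma (3.9) (p. 227)] -/
theorem neronDefect_dilatation_add_one_le (hπ : Irreducible (algebraMap R S ϖ))
    (hres : LinearIndependent (ResidueField S)
      (fun j => (1 : ResidueField S) ⊗ₜ[B] D R B (g j)))
    (hresκ : LinearIndependent (ResidueField L)
      (fun j => (1 : ResidueField L) ⊗ₜ[B] D R B (g j)))
    [Module.Free L (L ⊗[B ⧸ I] Ω[(B ⧸ I)⁄R])]
    (hinj : Function.Injective (Ideal.quotientMap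
      (Ideal.span {algebraMap R (dilatation ϖ (centreIdeal ϖ I g)) ϖ})
      (algebraMap (B ⧸ I) (dilatation ϖ (centreIdeal ϖ I g)))
      (Ideal.map_le_iff_le_comap.mp (map_centreIdeal_dilatation_le ϖ I g))))
    (hI : I ≤ centreIdealB ϖ g)
    (hunit : ∀ t : B, Ideal.Quotient.mk (centreIdealB ϖ g) t ∉ 𝔓 → IsUnit (algebraMap B S t))
    (hδ : neronDefect R (B ⧸ I) S ≠ 0) :
    neronDefect R (dilatation ϖ (centreIdeal ϖ I g)) S + 1 ≤ neronDefect R (B ⧸ I) S := by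
  obtain ⟨p, hdrop, hp⟩ := neronDefect_dilatation_add_le_aux ϖ I g 𝔓 L S hπ hres hresκ hinj hI hunit
  -- the numerics `q ≥ rank + 1`
  have hq' := length_quotSMulTop_tensor_kaehler_eq_finrank R (B ⧸ I) S L hπ
  have htors : Submodule.torsion S (S ⊗[B ⧸ I] Ω[(B ⧸ I)⁄R]) ≠ ⊥ := by
    intro h
    exact hδ ((neronDefect_eq_zero_iff R (B ⧸ I) S).mpr h)
  have hnum := finrank_add_one_le_length_quotSMulTop (S ⊗[B ⧸ I] Ω[(B ⧸ I)⁄R]) hπ htors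
  rw [hq'] at hnum
  set δ' := neronDefect R (dilatation ϖ (centreIdeal ϖ I g)) S
  set δ := neronDefect R (B ⧸ I) S
  set N := Module.finrank B Ω[B⁄R]
  set q := Module.finrank L (L ⊗[B ⧸ I] Ω[(B ⧸ I)⁄R])
  set m := Module.finrank S (S ⊗[B ⧸ I] Ω[(B ⧸ I)⁄R])
  have hfin : ((N : ℕ) : ℕ∞) ≠ ⊤ := ENat.coe_ne_top _
  have key : δ' + 1 + N ≤ δ + N := by
    calc δ' + 1 + (N : ℕ∞) = δ' + N + 1 := by ring
      _ ≤ δ + p + m + 1 := add_le_add hdrop le_rfl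
      _ = δ + p + (m + 1) := by ring
      _ ≤ δ + p + q := add_le_add le_rfl hnum
      _ = δ + ((p + q : ℕ) : ℕ∞) := by push_cast; ring
      _ = δ + N := by rw [hp]
  exact (WithTop.add_le_add_iff_right hfin).mp key

end Literature.AlgebraicGeometry.Smoothening
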